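import Summits.HodgeConjecture.HodgeConjecture.Theorems.K2E1PinnedGFunctionalOfDiscreteSum
import HarnessLib

/-!
# K2·E1 — PINNING the `H`-side functional of (13.8.3) at `v`: only the globalising packet `ρ` (with `ρ_v = St_H(ξ_v)`) contributes, with weight `2`, so
# `trH(f^H) := Σ'_ρ' m(ρ') Tr ρ'(f^H ⊗ (f^v)^H) = 2 · Tr St_H(ξ_v)(f^H)` — the shape of ★ `FlathHHyp`

Cell `hodgecm-mathlib`, Track B ∕ K2-LIT, squad K2, ENGINE E1 (line `K2_E1_TraceFormulaBeta`, rows 13∕18∕22 on the `H` side); crux H413 = `stmt-HodgeConjecture-24833` (route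
`HCCMUnconditional`); seat K2E1-p09 (g0), DEAL K2E1-plan (g0) 2026-09-03T22:52:54Z (the `H`-side twin of ★ p855370).  PROOF FILE, lane `--supports stmt-HodgeConjecture-24833
--as helper`: THEOREMS ONLY (the functional is ★ `pinnedDiscreteSum` of p855370 applied to the `H`-datum), no instance, no notation, no named fact, no `sorry`.  Closes no
socket.  HONEST LABEL: HC_CM is proved only modulo the 7 printed citations (2 remaining named inputs: hLiu418 = `stmt-HodgeConjecture-24832`, h413 =
`stmt-HodgeConjecture-24833`) until rung 0 closes; nothing here changes that count.

WHAT.  [Rogawski1990, §13.8 p. 218, last lines]: on the `H`-side of (13.8.3) the frozen test vector `(f^v)^H` (pseudo-coefficients of `ρ_u` at the archimedean places, units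
elsewhere) kills every discrete `ρ′ ≠ ρ`, and «`Tr ρ_u(f_u^H) = 2`», `m(ρ) = 1`; with Flath, `Tr ρ(f^H ⊗ (f^v)^H) = 2 · Tr ρ_v(f^H_v) = 2 · Tr St_H(ξ_v)(f^H)`.  In the currency of ★
p855297 ∕ p855370 (ANY adelic group datum `𝒢` — here the `H`-datum — automorphic `μ`, `ν`, a freezing map `Φ`): if a SINGLE class `c₀` contributes to
`Σ'_c m(c) · Tr c(Φ f^H)` (H-cut + H-pin) and `m(c₀) · Tr c₀(Φ f^H) = 2 · t₀` (H-Flath at `c₀` with `m(c₀) · w = 2`), then `pinnedDiscreteSum 𝒢 μ ν Φ f^H = 2 · t₀`;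
`pinnedDiscreteSum_eq_two_mul_smoothTrace` is the instance `t₀ := πSt.smoothTrace νHv f^H` — LITERALLY the right-hand side of ★ `FlathHHyp` (p855340).
Pure `tsum` bookkeeping (Mathlib `tsum_eq_single`); no trace-class hypothesis enters.

References: [Rogawski1990] §13.8 Prop. 13.8.3 (proof) p. 218 («`Tr ρ_u(f_u^H) = 2`»), display (13.8.3).  [FlathCorvallis1979] Thm. 3.
-/

set_option autoImplicit false
-- the mandated namespace has the single-problem summit's repeated segment (`HodgeConjecture.HodgeConjecture`)
set_option linter.dupNamespace false

noncomputable section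

namespace Summit.HodgeConjecture.HodgeConjecture.Cruxes.H413.K2E1PinnedHFunctionalOfDiscreteSum

open MeasureTheory NumberField CompactlySupported
open Literature.NumberTheory.Automorphic
open Summit.HodgeConjecture.HodgeConjecture.Cruxes.H413.K2E1SpectralTermsDiscreteHalf
open Summit.HodgeConjecture.HodgeConjecture.Cruxes.H413.K2E1PinnedGFunctionalOfDiscreteSum

universe u

section Generic

variable {K : Type} [Field K] [NumberField K] {𝒢 : AdelicGroupData.{u} K} {μ : Measure 𝒢.automorphicQuotient} [𝒢.IsAutomorphicMeasure μ]
  [MeasurableSpace 𝒢.Adelic] [BorelSpace 𝒢.Adelic] (ν : Measure 𝒢.Adelic) [IsFiniteMeasureOnCompacts ν]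

/-- **A SINGLE CONTRIBUTING CLASS.**  If every class `c ≠ c₀` contributes `0` to `Σ'_c m(c) · Tr c(F)` (H-cut + H-pin: the frozen vector kills all other discrete
`ρ′`), then `discreteSumG F = m(c₀) · Tr c₀(F)` (Mathlib `tsum_eq_single`). [cite: Rogawski1990, §13.8 Prop. 13.8.3 (proof) p. 218] -/
theorem discreteSumG_eq_of_single (F : C_c(𝒢.Adelic, ℂ)) (c₀ : DiscreteClass 𝒢 μ)
    (hoff : ∀ c : DiscreteClass 𝒢 μ, c ≠ c₀ → ((c.mult).toNat : ℂ) * c.classTrace ν F = 0) :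
    discreteSumG 𝒢 μ ν F = ((c₀.mult).toNat : ℂ) * c₀.classTrace ν F :=
  tsum_eq_single c₀ hoff

/-- **Single class + Flath weight `2`**: if moreover `m(c₀) · Tr c₀(F) = 2 · t₀` — print's «`Tr ρ_u(f_u^H) = 2`», `m(ρ) = 1`, `Tr ρ_v(f_v^H) = t₀` after Flath — then
`discreteSumG F = 2 · t₀`. [cite: Rogawski1990, §13.8 Prop. 13.8.3 (proof) p. 218] [cite: FlathCorvallis1979, Thm. 3] -/
theorem discreteSumG_eq_two_mul (F : C_c(𝒢.Adelic, ℂ)) (c₀ : DiscreteClass 𝒢 μ)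
    (hoff : ∀ c : DiscreteClass 𝒢 μ, c ≠ c₀ → ((c.mult).toNat : ℂ) * c.classTrace ν F = 0) (t₀ : ℂ)
    (h₀ : ((c₀.mult).toNat : ℂ) * c₀.classTrace ν F = 2 * t₀) :
    discreteSumG 𝒢 μ ν F = 2 * t₀ := by
  rw [discreteSumG_eq_of_single ν F c₀ hoff, h₀]

/-- The same decomposed into the three printed inputs: multiplicity `m(c₀) = 1`, Flath `Tr c₀(F) = w · t₀`, and the weight `w = 2` of the frozen vector.
[cite: Rogawski1990, §13.8 Prop. 13.8.3 (proof) p. 218] [cite: FlathCorvallis1979, Thm. 3] -/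
theorem discreteSumG_eq_two_mul_of_mult_eq_one (F : C_c(𝒢.Adelic, ℂ)) (c₀ : DiscreteClass 𝒢 μ)
    (hoff : ∀ c : DiscreteClass 𝒢 μ, c ≠ c₀ → ((c.mult).toNat : ℂ) * c.classTrace ν F = 0) (hm : c₀.mult = 1)
    (w t₀ : ℂ) (hFl : c₀.classTrace ν F = w * t₀) (hw : w = 2) :
    discreteSumG 𝒢 μ ν F = 2 * t₀ := by
  refine discreteSumG_eq_two_mul ν F c₀ hoff t₀ ?_
  rw [hm, hFl, hw]
  simp

/-- **THE PINNED `H`-FUNCTIONAL**: for a freezing map `Φ` (`f^H ↦ f^H ⊗ (f^v)^H`), under single-class contribution with weight `2`: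
`pinnedDiscreteSum 𝒢 μ ν Φ f^H = 2 · t₀`. [cite: Rogawski1990, §13.8 Prop. 13.8.3 (proof) p. 218] -/
theorem pinnedDiscreteSum_eq_two_mul {X : Type*} (Φ : X → C_c(𝒢.Adelic, ℂ)) (fH : X) (c₀ : DiscreteClass 𝒢 μ)
    (hoff : ∀ c : DiscreteClass 𝒢 μ, c ≠ c₀ → ((c.mult).toNat : ℂ) * c.classTrace ν (Φ fH) = 0) (t₀ : ℂ)
    (h₀ : ((c₀.mult).toNat : ℂ) * c₀.classTrace ν (Φ fH) = 2 * t₀) :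
    pinnedDiscreteSum 𝒢 μ ν Φ fH = 2 * t₀ :=
  discreteSumG_eq_two_mul ν (Φ fH) c₀ hoff t₀ h₀

end Generic

/-! ## The shape of ★ `FlathHHyp`: `t₀ := πSt.smoothTrace νHv f^H` on the local group `H_v` -/

section Local

variable {K : Type} [Field K] [NumberField K] {𝒢 : AdelicGroupData.{u} K} {μ : Measure 𝒢.automorphicQuotient} [𝒢.IsAutomorphicMeasure μ]
  [MeasurableSpace 𝒢.Adelic] [BorelSpace 𝒢.Adelic] (ν : Measure 𝒢.Adelic) [IsFiniteMeasureOnCompacts ν]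
  {Hv : Type u} [TopologicalSpace Hv] [Group Hv] [IsTopologicalGroup Hv] [MeasurableSpace Hv] (νHv : Measure Hv)

/-- **`trH(f^H) = 2 · Tr St_H(ξ_v)(f^H)`** — the conclusion shape of ★ `FlathHHyp` (p855340): for the `H`-datum `𝒢`, a freezing map `Φ : (H_v → ℂ) → C_c(H(𝔸), ℂ)` and the
local class `πSt : IrrClass H_v` (★ `IrrClass.smoothTrace`), single-class contribution with weight `2` and Flath at `v` give
`pinnedDiscreteSum 𝒢 μ ν Φ f^H = 2 * πSt.smoothTrace νHv f^H`. [cite: Rogawski1990, §13.8 Prop. 13.8.3 (proof) p. 218] [cite: FlathCorvallis1979, Thm. 3] -/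
theorem pinnedDiscreteSum_eq_two_mul_smoothTrace (Φ : (Hv → ℂ) → C_c(𝒢.Adelic, ℂ)) (fH : Hv → ℂ) (πSt : IrrClass Hv)
    (c₀ : DiscreteClass 𝒢 μ) (hoff : ∀ c : DiscreteClass 𝒢 μ, c ≠ c₀ → ((c.mult).toNat : ℂ) * c.classTrace ν (Φ fH) = 0)
    (h₀ : ((c₀.mult).toNat : ℂ) * c₀.classTrace ν (Φ fH) = 2 * πSt.smoothTrace νHv fH) :
    pinnedDiscreteSum 𝒢 μ ν Φ fH = 2 * πSt.smoothTrace νHv fH :=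
  pinnedDiscreteSum_eq_two_mul ν Φ fH c₀ hoff _ h₀

/-- **THE PRINTED ROUTE TO THE SAME SHAPE** (H-cut + H-Flath-per-class + H-pin): cut the `H`-side discrete sum to a finite injective family of classes `cl i` (all other
classes contribute `0`), write Flath at `v` per class, `Tr (cl i)(Φ f^H) = ε i · Tr (locv i)(f^H)` with `locv i : IrrClass H_v` the `v`-component and `ε i ∈ ℤ` the frozen
weight away from `v`, and PIN: the frozen vector kills every class whose `v`-component is not `πSt = St_H(ξ_v)` (`ε i = 0`), while the surviving weights add up to
`Σ m(cl i) · ε i = 2` (print: exactly one `ρ`, `m(ρ) = 1`, «`Tr ρ_u(f_u^H) = 2`»).  Then `pinnedDiscreteSum 𝒢 μ ν Φ f^H = 2 · πSt.smoothTrace νHv f^H` — ★ `FlathHHyp`'s shape.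
[cite: Rogawski1990, §13.8 Prop. 13.8.3 (proof) p. 218, display (13.8.3)] [cite: FlathCorvallis1979, Thm. 3] -/
theorem pinnedDiscreteSum_eq_two_mul_smoothTrace_of_cut (Φ : (Hv → ℂ) → C_c(𝒢.Adelic, ℂ)) (fH : Hv → ℂ) (πSt : IrrClass Hv)
    {ι : Type*} [Finite ι] (cl : ι → DiscreteClass 𝒢 μ) (hcl : Function.Injective cl)
    (hoff : ∀ c : DiscreteClass 𝒢 μ, c ∉ Set.range cl → ((c.mult).toNat : ℂ) * c.classTrace ν (Φ fH) = 0)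
    (locv : ι → IrrClass Hv) (ε : ι → ℤ) (hFl : ∀ i, (cl i).classTrace ν (Φ fH) = (ε i : ℂ) * (locv i).smoothTrace νHv fH)
    (hpin : ∀ i, locv i ≠ πSt → ε i = 0) (htwo : ∑ᶠ i : ι, (((cl i).mult).toNat : ℂ) * (ε i : ℂ) = 2) :
    pinnedDiscreteSum 𝒢 μ ν Φ fH = 2 * πSt.smoothTrace νHv fH := by
  rw [pinnedDiscreteSum_eq_finsum ν Φ fH cl hcl hoff ε (fun i => (locv i).smoothTrace νHv fH) hFl]
  have hterm : ∀ i : ι, (((cl i).mult).toNat : ℂ) * ((ε i : ℂ) * (locv i).smoothTrace νHv fH) =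
      ((((cl i).mult).toNat : ℂ) * (ε i : ℂ)) * πSt.smoothTrace νHv fH := by
    intro i
    by_cases h : locv i = πSt
    · rw [h, mul_assoc]
    · rw [hpin i h]
      simp
  rw [finsum_congr hterm, ← finsum_mul, htwo]

/-- **Single survivor of the cut** — the literal print situation: in the finite cut exactly ONE index `i₀` carries a non-zero frozen weight, its `v`-component is
`πSt = St_H(ξ_v)`, its class has multiplicity `m = 1` [Rogawski1990, Thm. 13.3.1] and frozen weight `ε i₀ = 2` («`Tr ρ_u(f_u^H) = 2`»); every other index is pinned to
`ε i = 0`.  Then `pinnedDiscreteSum 𝒢 μ ν Φ f^H = 2 · πSt.smoothTrace νHv f^H`. [cite: Rogawski1990, §13.8 Prop. 13.8.3 (proof) p. 218] [cite: FlathCorvallis1979, Thm. 3] -/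
theorem pinnedDiscreteSum_eq_two_mul_smoothTrace_of_unique (Φ : (Hv → ℂ) → C_c(𝒢.Adelic, ℂ)) (fH : Hv → ℂ) (πSt : IrrClass Hv)
    {ι : Type*} [Finite ι] (cl : ι → DiscreteClass 𝒢 μ) (hcl : Function.Injective cl)
    (hoff : ∀ c : DiscreteClass 𝒢 μ, c ∉ Set.range cl → ((c.mult).toNat : ℂ) * c.classTrace ν (Φ fH) = 0)
    (locv : ι → IrrClass Hv) (ε : ι → ℤ) (hFl : ∀ i, (cl i).classTrace ν (Φ fH) = (ε i : ℂ) * (locv i).smoothTrace νHv fH)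
    (i₀ : ι) (h₀ : locv i₀ = πSt) (hpin : ∀ i, i ≠ i₀ → ε i = 0) (hm : (cl i₀).mult = 1) (hε : ε i₀ = 2) :
    pinnedDiscreteSum 𝒢 μ ν Φ fH = 2 * πSt.smoothTrace νHv fH := by
  refine pinnedDiscreteSum_eq_two_mul_smoothTrace_of_cut ν νHv Φ fH πSt cl hcl hoff locv ε hFl ?_ ?_
  · intro i hi
    exact hpin i (fun h => hi (h ▸ h₀))
  · rw [finsum_eq_single _ i₀ (fun i hi => by rw [hpin i hi]; simp), hm, hε]
    simp

end Local

end Summit.HodgeConjecture.HodgeConjecture.Cruxes.H413.K2E1PinnedHFunctionalOfDiscreteSum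

end
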